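import Summits.BirchSwinnertonDyer.BirchSwinnertonDyer.Theses.ThetaPartnerAtTwo
import Summits.BirchSwinnertonDyer.BirchSwinnertonDyer.Theorems.ThetaPartnerAtTwoSignedKatoUpToAtTwoFlatCurrencyBridge
import Summits.BirchSwinnertonDyer.Rank1Residual.Supersingular.SprungPollackConsistency
import Literature.NumberTheory.EllipticCurves.Kato2004.IwasawaCohomology
import Literature.NumberTheory.EllipticCurves.KatoFineSelmerDualTorsion
import Literature.NumberTheory.EllipticCurves.KatoDivisibilitySkeletonProofs
import Literature.NumberTheory.EllipticCurves.Sprung2012.SharpFlatSelmerModuleFiniteProofs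
import Literature.NumberTheory.EllipticCurves.TateModuleContinuityProofs
import Literature.NumberTheory.EllipticCurves.CyclotomicZpExtensionLocalGeneratorProofs
import HarnessLib

/-!
# Route `ThetaPartnerAtTwo` (TP2), crux K3 `SignedKatoDivisibilityUpToAtTwo` (item stmt-BirchSwinnertonDyer-20308),
# line `colemanrat` — file 24: **K3 BY NAME FROM KATO'S PUBLISHED FACTS AND THE RATIONAL ♭ COLEMAN–KATO PACKAGE AT `2`**
# — the `bsd-2adic` cell's CK♭ package (F1♭ · F3♭ · F4rat, the conjunct of `FlatUniformTwo.stub_allFlatData`, line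
# `flat_uniform_two`, crux 19097) for Honda data of that line's shape on the `a_2 = 0` sub-row, WITHOUT its `2`-adic-image clause
# F4@(2) — K3 is an «up to a power of `2`» statement, so Kato's Thm. 12.5 (3) (no image hypothesis) suffices

HONEST FRAMING (cell `bsd-wall`, width seat `bsd-wall-tp2-p2x-w2` g2): THEOREMS ONLY — no definition, no named fact, no instance, no
`sorry`; the K3-level theorem is CONDITIONAL (`proof.conditional`) on two PUBLISHED named facts (`Kato2004.thm12_4` — Kato Thm. 12.4;
`Kato2004_fineSelmerDual_isTorsion` — Kato Thm. 12.4 (1) ∘ (17.13.1)) and on the displayed package hypothesis (CK♭rat@2), which is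
PRINT-at-odd-`p` / READ-at-`2` (Sprung 2012 Prop. 7.19, Def. 6.1 / Prop. 6.3–6.5; Kato Thm. 12.5 (3)) and NOT a tree theorem; closes no
item; BSD is NOT proved by any of this.

## Why this file

K3 asks, for every pinned dual `D` of Kobayashi's `Sel⁺(E/ℚ_∞)` on the theta habitat (`a_2 = 0`), `Char(D.X) = (g)` with
`g·h = 2^m ϖ L` in `ℚ₂⟦T⟧` (`L = kobayashiL 1 L⁺ L⁻ = L⁻` for the Pollack pair, `ϖ` the period ratio). By file 23
(`flatLine_sharpFlat_signed_agree_two`), for the K4 Honda system `c` and any lift `g` — data of EXACTLY the shape the `bsd-2adic` line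
quantifies over — every pinned ♭ dual `D♭` of Sprung's `Sel♭(E/ℚ_∞)` (spelled with `ap := W.frobeniusTrace 2`) has
`Char(D♭.X) = Char(D.X)`. At trace `0` a Pollack pair IS a Sprung pair (`isSprungPair_zero_iff`, labelling `L♯ = L⁺`, `L♭ = L⁻`).
So the `bsd-2adic` cell's CK♭ package for `D♭` — a Poitou–Tate skeleton `𝐇¹ →loc P ↪ Λ`, `P →toX X♭ →δ X⁰` exact, Kato's `G = ϖ·L♭ ∈ loc(Z)`,
and the Euler-system bound `ℓ_𝔭(X⁰) ≤ ℓ_𝔭(𝐇¹/Z)` at height-one `𝔭 ∌ 2` — gives, by the tree's module theory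
(`Kato2004.thm17_4_skeleton`, `Module.exists_pow_mul_mem_charIdeal_of_lengthAt_le`), `2^m G ∈ Char(X♭) = Char(X⁺) = (g)`, i.e. K3's
conclusion. The clause F4@(2) (Kato 12.5 (4) at `𝔭 ∋ 2`, the `bsd-2adic` cell's one P-ASSERT token) is NOT needed: K3 absorbs powers of `2`.
NET: K3's research content ⊆ {Kato 12.4 PUB, X⁰ torsion PUB, CK♭rat@2 on `a_2 = 0`} — the SAME reading items as the `bsd-2adic` cell's
`a_2 = 0` sub-row minus its image token; no separate local Tate-pairing infrastructure is required on this road (the pairing is inside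
the package's `loc`).

## What is proved

* `signedKatoDivisibilityUpToAtTwo_of_flatColemanKatoRat` — **`SignedKatoDivisibilityUpToAtTwo`** from `Kato2004.thm12_4`,
  `Kato2004_fineSelmerDual_isTorsion` and (CK♭rat@2): for every habitat datum, every `v ∋ 2`, every `(g, c)` with [lift · levels ·
  Sprung's trace relation · dual level-`0` generation (a) (b)] (VERBATIM the Honda₂ clause shapes of `stub_allFlatData`), every newform /
  period ratio, every Sprung pair `(L♯, L♭)` at `2` and every pinned `D♭`: `∃ I Y P loc toX δ Z G` with F1♭ (two exactness clauses),
  `G ∈ loc(Z)`, F3♭ `ι G = ϖ·ι L♭`, F4rat.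

References: [Kato2004Asterisque] K. Kato, Astérisque 295 (2004), Thm. 12.4, Thm. 12.5 (3), Thm. 17.4, §17.13; [Sprung2012] Def. 6.1,
Prop. 7.19, Thm. 7.14, 7.16; [Kobayashi2003] Thm. 1.3 (i); [Pollack2003] Prop. 6.18; [Sprung2017] Thm. 1.12; [KuriharaOtsuki2006] p. 557.
-/

set_option autoImplicit false
-- the Theorems namespace of this sub repeats the summit name by design (D-0017 nested layout)
set_option linter.dupNamespace false

noncomputable section

open scoped Classical MatrixGroups ModularForm NumberField

universe u

namespace Summit.BirchSwinnertonDyer.BirchSwinnertonDyer.Theorems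

namespace SignedKatoOffTwo.FlatKernel

open CongruenceSubgroup NumberField IsDedekindDomain WeierstrassCurve Field
  Literature.NumberTheory.GaloisRepresentations
  Literature.NumberTheory.EllipticCurves Literature.NumberTheory.EllipticCurves.ModularForms
  Literature.NumberTheory.EllipticCurves.Module Literature.NumberTheory.EllipticCurves.Rank1Residual
  Literature.NumberTheory.EllipticCurves.Kobayashi2003 Literature.NumberTheory.EllipticCurves.Sprung2012
  Literature.NumberTheory.EllipticCurves.Sprung2017 ZpExtension
  Summit.BirchSwinnertonDyer.Rank1Residual.Supersingular
  Summit.BirchSwinnertonDyer.BirchSwinnertonDyer.Theses.ThetaPartnerAtTwo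

/-- A finite place of `ℚ` above `2` exists. [folklore] -/
private theorem exists_heightOneSpectrum_two_mem'' : ∃ v : HeightOneSpectrum (𝓞 ℚ), (2 : 𝓞 ℚ) ∈ v.asIdeal := by
  have hnu : ¬ IsUnit ((2 : ℕ) : 𝓞 ℚ) := by
    intro h
    have h' := h.map Rat.ringOfIntegersEquiv
    rw [map_natCast, Int.isUnit_iff_natAbs_eq, Int.natAbs_natCast] at h'
    exact absurd h' (by norm_num)
  obtain ⟨M, hM, hle⟩ := Ideal.exists_le_maximal (Ideal.span {((2 : ℕ) : 𝓞 ℚ)})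
    (by rwa [Ne, Ideal.span_singleton_eq_top])
  have h2M : ((2 : ℕ) : 𝓞 ℚ) ∈ M := hle (Ideal.mem_span_singleton_self _)
  refine ⟨⟨M, hM.isPrime, fun hbot => ?_⟩, by exact_mod_cast h2M⟩
  rw [hbot, Ideal.mem_bot] at h2M
  exact absurd (by exact_mod_cast h2M : (2 : ℕ) = 0) (by norm_num)

/-- **K3 `SignedKatoDivisibilityUpToAtTwo` BY NAME from Kato's Thm. 12.4, the torsion of `X⁰`, and the RATIONAL ♭ Coleman–Kato package at
`2` on the `a_2 = 0` sub-row.** Hypotheses: `h124 : Kato2004.thm12_4` (PUB), `hX0 : Kato2004_fineSelmerDual_isTorsion` (PUB), and (CK♭rat@2):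
for every curve of the theta habitat, the cyclotomic datum, every place `v ∋ 2`, every local datum `(g, c)` with `g` a lift of the
generator, (levels), Sprung's trace relation and dual level-`0` generation (a) (b), every newform `f` / period ratio `ϖ`, every Sprung
pair `(L♯, L♭)` at `2` and every pinned `D♭ : SharpFlatSelmerDualData W κ γ (closureEmb ℚ_v) (W.frobeniusTrace 2) g c .flat`: a skeleton
`(I, Y, P, loc, toX, δ, Z, G)` with `Exact loc toX`, `Exact toX δ`, `G ∈ loc(Z)` (inside `P ≤ Λ`), `ι G = ϖ·ι L♭`, and
`ℓ_𝔭(Y.X) ≤ ℓ_𝔭(I.H/Z)` at every height-one `𝔭 ∌ 2`. Proof: at `a_2 = 0` K3's Pollack pair is a Sprung pair; take the K4 Honda system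
(file 23: it has the required shape and `Char(D♭.X) = Char(D.X)` for every pinned pair); Kato's module theory gives `2^m G ∈ Char(D♭.X)`;
read it in `Char(D.X) = (g)`. [cite: Kato2004Asterisque, Thm. 12.4 (p. 221), Thm. 12.5 (3) (p. 222), Thm. 17.4 and §17.13 (pp. 273, 279–280)]
[cite: Sprung2012, Prop. 7.19, Thm. 7.16 (pp. 1504–1505)] [cite: Kobayashi2003, Thm. 1.3 (i)] [cite: Pollack2003, Prop. 6.18] -/
theorem signedKatoDivisibilityUpToAtTwo_of_flatColemanKatoRat (h124 : Kato2004.thm12_4)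
    (hX0 : Kato2004_fineSelmerDual_isTorsion)
    (hCK : ∀ (W : WeierstrassCurve ℚ) [W.IsElliptic] [W.IsGloballyMinimal],
      ¬ W.HasCM → W.analyticRank = 0 → GoodSS W 2 → W.frobeniusTrace 2 = 0 →
      ∀ (κ : ZpExtension ℚ 2) (γ : Field.absoluteGaloisGroup ℚ),
        κ.IsCyclotomic → κ.IsTopGenerator γ → IsCyclotomicVariable 2 γ →
      ∀ (v : HeightOneSpectrum (𝓞 ℚ)), (2 : 𝓞 ℚ) ∈ v.asIdeal →
      ∀ (g : Field.absoluteGaloisGroup (v.adicCompletion ℚ)) (c : ℕ → localPoints W (v.adicCompletion ℚ)),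
        κ.IsTopGenerator (resGalOfEmb (closureEmb (K := ℚ) (v.adicCompletion ℚ)) g) →
        (∀ n, c n ∈ localLayerPointsOfEmb κ (closureEmb (K := ℚ) (v.adicCompletion ℚ)) W n) →
        (∀ n, 1 ≤ n → localTraceOfEmb κ (closureEmb (K := ℚ) (v.adicCompletion ℚ)) W n (n + 1)
          (c (n + 1)) = W.frobeniusTrace 2 • c n - c (n - 1)) →
        (∀ z₀ : localLayerPointsOfEmb κ (closureEmb (K := ℚ) (v.adicCompletion ℚ)) W 0 →+ ℤ_[2],
          evalOn W (localLayerPointsOfEmb κ (closureEmb (K := ℚ) (v.adicCompletion ℚ)) W 0) z₀ (c 0) = 0 →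
            z₀ = 0) →
        (∀ a : ℤ_[2],
          (∃ z₀ : localLayerPointsOfEmb κ (closureEmb (K := ℚ) (v.adicCompletion ℚ)) W 0 →+ ℤ_[2],
            evalOn W (localLayerPointsOfEmb κ (closureEmb (K := ℚ) (v.adicCompletion ℚ)) W 0) z₀ (c 0) =
              2 * a) →
          ∃ y : localLayerPointsOfEmb κ (closureEmb (K := ℚ) (v.adicCompletion ℚ)) W 0 →+ ℤ_[2],
            evalOn W (localLayerPointsOfEmb κ (closureEmb (K := ℚ) (v.adicCompletion ℚ)) W 0) y (c 0) = a) →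
      ∀ [NeZero (W.conductorNorm ℤ)] (f : CuspForm (Gamma0 (W.conductorNorm ℤ)) 2),
          IsNewformOf W f → ∀ (ϖ : ℚ), (ϖ : ℝ) * W.realPeriodRat = plusPeriod f →
        ∀ (Ls Lf : IwasawaAlgebra 2), IsSprungPair f 2 (W.frobeniusTrace 2) Ls Lf →
        ∀ (D : SharpFlatSelmerDualData W κ γ (closureEmb (K := ℚ) (v.adicCompletion ℚ))
            (W.frobeniusTrace 2) g c .flat) [ContinuousSMul ℤ_[2] (W.tateModule 2)],
          ∃ (I : Kato2004.IwasawaH1Data W 2 κ γ) (Y : W.FineSelmerDualData κ γ)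
            (P : Submodule (IwasawaAlgebra 2) (IwasawaAlgebra 2))
            (loc : I.H →ₗ[IwasawaAlgebra 2] P) (toX : P →ₗ[IwasawaAlgebra 2] D.X)
            (δ : D.X →ₗ[IwasawaAlgebra 2] Y.X) (Z : Submodule (IwasawaAlgebra 2) I.H)
            (G : IwasawaAlgebra 2),
            Function.Exact loc toX ∧ Function.Exact toX δ ∧
            G ∈ Submodule.map (P.subtype ∘ₗ loc) Z ∧
            iwasawaToPowerSeries 2 G = PowerSeries.C (ϖ : ℚ_[2]) * iwasawaToPowerSeries 2 Lf ∧
            (∀ 𝔭 : PrimeSpectrum (IwasawaAlgebra 2), 𝔭.asIdeal.height = 1 →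
              PowerSeries.C (2 : ℤ_[2]) ∉ 𝔭.asIdeal →
              lengthAt (IwasawaAlgebra 2) Y.X 𝔭 ≤ lengthAt (IwasawaAlgebra 2) (I.H ⧸ Z) 𝔭)) :
    SignedKatoDivisibilityUpToAtTwo := by
  unfold SignedKatoDivisibilityUpToAtTwo
  intro W _ _ hcm hr hss ha κ γ hκ hγ hcv _ f hf ϖ hϖ Lplus Lminus hPP D
  obtain ⟨-, -, hodd, heven⟩ := hPP
  have hSP : IsSprungPair f 2 (W.frobeniusTrace 2) Lplus Lminus := by
    rw [ha]
    exact (isSprungPair_zero_iff f 2 Lplus Lminus).mpr ⟨hodd, heven⟩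
  have hKL : kobayashiL 1 Lplus Lminus = Lminus := by simp [kobayashiL]
  -- the place, a local lift, the K4 Honda system in the 19097 line's clause shapes, a pinned ♭ dual with `Char` agreeing
  obtain ⟨v, hv⟩ := exists_heightOneSpectrum_two_mem''
  obtain ⟨gl, hgl⟩ := hκ.exists_isTopGenerator_resGalOfEmb_adicCompletion v (by exact_mod_cast hv)
  obtain ⟨c, hc, htrc, hg0a, hg0b, -, hdual⟩ := flatLine_sharpFlat_signed_agree_two W hss ha hκ v hv hgl
  obtain ⟨Df⟩ := nonempty_sharpFlatSelmerDualData' W κ (closureEmb (K := ℚ) (v.adicCompletion ℚ))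
    (W.frobeniusTrace 2) gl c Chroma.flat γ
  obtain ⟨-, -, hchar, -⟩ := hdual D Df
  haveI : ContinuousSMul ℤ_[2] (W.tateModule 2) := TateModule.continuousSMul_padicInt
  obtain ⟨I, Y, P, loc, toX, δ, Z, G, hPX, hXY, hGZ, hιG, hES⟩ :=
    hCK W hcm hr hss ha κ γ hκ hγ hcv v hv gl c hgl hc htrc hg0a hg0b f hf ϖ hϖ Lplus Lminus hSP Df
  -- `Char(X⁺) = (g)` (`Λ` is a UFD)
  obtain ⟨g, hg⟩ := (charIdeal_isPrincipal_holds 2 D.X).principal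
  have hgD : D.charIdeal = Ideal.span {g} := hg
  have h2 : iwasawaToPowerSeries 2 (PowerSeries.C (2 : ℤ_[2])) = PowerSeries.C (2 : ℚ_[2]) := by
    show PowerSeries.map _ _ = _
    rw [PowerSeries.map_C, map_ofNat]
  by_cases hG : G = 0
  · -- degenerate case `G = 0` (then `ϖ = 0`): `h = 0`, `m = 0`
    refine ⟨g, 0, 0, hgD, ?_⟩
    rw [hG, map_zero] at hιG
    rw [mul_zero, map_zero, pow_zero, one_mul, hKL]
    exact hιG
  · obtain ⟨htf, hrank⟩ := h124.isTorsionFree_and_rank_le_one W 2 hκ hγ I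
    haveI := htf
    haveI : Module.Finite (IwasawaAlgebra 2) Df.X := Df.moduleFinite hγ
    obtain ⟨htors, hlen⟩ := Kato2004.thm17_4_skeleton hrank loc toX δ hPX hXY P.subtype P.injective_subtype
      (hX0 W 2 κ γ hκ hγ Y) Z hG hGZ
    obtain ⟨m, hm⟩ := exists_pow_mul_mem_charIdeal_of_lengthAt_le htors (IwasawaAlgebra.prime_C 2) hG
      fun 𝔭 h1 hp𝔭 ↦ hlen 𝔭 (hES 𝔭 h1 hp𝔭)
    have hm' : PowerSeries.C (2 : ℤ_[2]) ^ m * G ∈ Ideal.span {g} := by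
      rw [← hgD, ← hchar]
      exact hm
    obtain ⟨h, hh⟩ := Ideal.mem_span_singleton'.mp hm'
    refine ⟨g, h, m, hgD, ?_⟩
    rw [mul_comm g h, hh]
    simp only [map_mul, map_pow, hιG, hKL, h2]
    ring

/-- **K3 `SignedKatoDivisibilityUpToAtTwo` BY NAME from Kato's facts and the ∃-FORM of the rational ♭ package** (the weakest form, and the
honest reading of Sprung's construction: ONE Honda system per datum). Hypothesis (CK♭rat@2∃): for every curve of the theta habitat, the
cyclotomic datum, every newform `f` / period ratio `ϖ` and every Sprung pair `(L♯, L♭)` at `2`, THERE ARE a place `v ∋ 2`, a local lift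
`g` and a plus Honda system `d` at `2` with the four clauses (L) (TR) (GEN) (GEN₀) (the K4 shape — satisfied by Sprung's Thm. 2.2 system and
by the K4 system) such that every pinned `D♭ : SharpFlatSelmerDualData W κ γ (closureEmb ℚ_v) (W.frobeniusTrace 2) g d .flat` carries a rational
♭ Coleman–Kato skeleton (F1♭, `G ∈ loc(Z)`, F3♭, F4rat). Proof: `Sel⁺ = Sel♭(g, d)` for ANY such `d` (file 20), so `Char(D♭.X) = Char(D.X)`;
then as in `signedKatoDivisibilityUpToAtTwo_of_flatColemanKatoRat`. [cite: Kato2004Asterisque, Thm. 12.4, Thm. 12.5 (3), Thm. 17.4, §17.13]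
[cite: Sprung2012, Thm. 2.2 (2′), Prop. 7.19, Thm. 7.16] [cite: Kobayashi2003, Thm. 1.3 (i)] -/
theorem signedKatoDivisibilityUpToAtTwo_of_exists_flatColemanKatoRat (h124 : Kato2004.thm12_4)
    (hX0 : Kato2004_fineSelmerDual_isTorsion)
    (hCK : ∀ (W : WeierstrassCurve ℚ) [W.IsElliptic] [W.IsGloballyMinimal],
      ¬ W.HasCM → W.analyticRank = 0 → GoodSS W 2 → W.frobeniusTrace 2 = 0 →
      ∀ (κ : ZpExtension ℚ 2) (γ : Field.absoluteGaloisGroup ℚ),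
        κ.IsCyclotomic → κ.IsTopGenerator γ → IsCyclotomicVariable 2 γ →
      ∀ [NeZero (W.conductorNorm ℤ)] (f : CuspForm (Gamma0 (W.conductorNorm ℤ)) 2),
          IsNewformOf W f → ∀ (ϖ : ℚ), (ϖ : ℝ) * W.realPeriodRat = plusPeriod f →
        ∀ (Ls Lf : IwasawaAlgebra 2), IsSprungPair f 2 (W.frobeniusTrace 2) Ls Lf →
        ∃ (v : HeightOneSpectrum (𝓞 ℚ)) (_ : (2 : 𝓞 ℚ) ∈ v.asIdeal)
          (g : Field.absoluteGaloisGroup (v.adicCompletion ℚ)) (d : ℕ → localPoints W (v.adicCompletion ℚ)),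
          κ.IsTopGenerator (resGalOfEmb (closureEmb (K := ℚ) (v.adicCompletion ℚ)) g) ∧
          (∀ m, d m ∈ localLayerPointsOfEmb κ (closureEmb (K := ℚ) (v.adicCompletion ℚ)) W m) ∧
          (∀ m, localTraceOfEmb κ (closureEmb (K := ℚ) (v.adicCompletion ℚ)) W (m + 1) (m + 2) (d (m + 2)) = -d m) ∧
          (∀ m : ℕ, 1 ≤ m → ∀ P ∈ localLayerPointsOfEmb κ (closureEmb (K := ℚ) (v.adicCompletion ℚ)) W m,
            ∃ B ∈ AddSubgroup.closure (Set.range fun σ : Field.absoluteGaloisGroup (v.adicCompletion ℚ) ↦ σ • d m),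
              ∃ P' ∈ localLayerPointsOfEmb κ (closureEmb (K := ℚ) (v.adicCompletion ℚ)) W (m - 1),
              ∃ R ∈ localLayerPointsOfEmb κ (closureEmb (K := ℚ) (v.adicCompletion ℚ)) W m, P = B + P' + 2 • R) ∧
          (∀ P ∈ localLayerPointsOfEmb κ (closureEmb (K := ℚ) (v.adicCompletion ℚ)) W 0,
            ∃ a : ℤ, ∃ R ∈ localLayerPointsOfEmb κ (closureEmb (K := ℚ) (v.adicCompletion ℚ)) W 0, P = a • d 0 + 2 • R) ∧
          ∀ (D : SharpFlatSelmerDualData W κ γ (closureEmb (K := ℚ) (v.adicCompletion ℚ))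
              (W.frobeniusTrace 2) g d .flat) [ContinuousSMul ℤ_[2] (W.tateModule 2)],
            ∃ (I : Kato2004.IwasawaH1Data W 2 κ γ) (Y : W.FineSelmerDualData κ γ)
              (P : Submodule (IwasawaAlgebra 2) (IwasawaAlgebra 2))
              (loc : I.H →ₗ[IwasawaAlgebra 2] P) (toX : P →ₗ[IwasawaAlgebra 2] D.X)
              (δ : D.X →ₗ[IwasawaAlgebra 2] Y.X) (Z : Submodule (IwasawaAlgebra 2) I.H)
              (G : IwasawaAlgebra 2),
              Function.Exact loc toX ∧ Function.Exact toX δ ∧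
              G ∈ Submodule.map (P.subtype ∘ₗ loc) Z ∧
              iwasawaToPowerSeries 2 G = PowerSeries.C (ϖ : ℚ_[2]) * iwasawaToPowerSeries 2 Lf ∧
              (∀ 𝔭 : PrimeSpectrum (IwasawaAlgebra 2), 𝔭.asIdeal.height = 1 →
                PowerSeries.C (2 : ℤ_[2]) ∉ 𝔭.asIdeal →
                lengthAt (IwasawaAlgebra 2) Y.X 𝔭 ≤ lengthAt (IwasawaAlgebra 2) (I.H ⧸ Z) 𝔭)) :
    SignedKatoDivisibilityUpToAtTwo := by
  unfold SignedKatoDivisibilityUpToAtTwo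
  intro W _ _ hcm hr hss ha κ γ hκ hγ hcv _ f hf ϖ hϖ Lplus Lminus hPP D
  obtain ⟨-, -, hodd, heven⟩ := hPP
  have hSP : IsSprungPair f 2 (W.frobeniusTrace 2) Lplus Lminus := by
    rw [ha]
    exact (isSprungPair_zero_iff f 2 Lplus Lminus).mpr ⟨hodd, heven⟩
  have hKL : kobayashiL 1 Lplus Lminus = Lminus := by simp [kobayashiL]
  obtain ⟨v, hv, gl, d, hgl, hd, htr, hgen, hgen0, hpack⟩ :=
    hCK W hcm hr hss ha κ γ hκ hγ hcv f hf ϖ hϖ Lplus Lminus hSP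
  -- `Sel⁺ = Sel♭(gl, d)` for this Honda system (file 20), hence `Char(D♭.X) = Char(D.X)` in the `a_2(W)` spelling
  have heq0 := signedSelmerInfty_eq_sharpFlatSelmerInfty_flat_two W hss hκ v hv hgl hd htr hgen hgen0
  have key : ∀ (ap : ℤ), ap = 0 →
      ∀ (Df : SharpFlatSelmerDualData W κ γ (closureEmb (K := ℚ) (v.adicCompletion ℚ)) ap gl d .flat),
        Df.charIdeal = D.charIdeal := by
    rintro ap rfl Df
    exact charIdeal_sharpFlat_eq_charIdeal_signed W κ _ gl d heq0 Df D
  obtain ⟨Df⟩ := nonempty_sharpFlatSelmerDualData' W κ (closureEmb (K := ℚ) (v.adicCompletion ℚ))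
    (W.frobeniusTrace 2) gl d Chroma.flat γ
  have hchar : Df.charIdeal = D.charIdeal := key _ ha Df
  haveI : ContinuousSMul ℤ_[2] (W.tateModule 2) := TateModule.continuousSMul_padicInt
  obtain ⟨I, Y, P, loc, toX, δ, Z, G, hPX, hXY, hGZ, hιG, hES⟩ := hpack Df
  obtain ⟨g, hg⟩ := (charIdeal_isPrincipal_holds 2 D.X).principal
  have hgD : D.charIdeal = Ideal.span {g} := hg
  have h2 : iwasawaToPowerSeries 2 (PowerSeries.C (2 : ℤ_[2])) = PowerSeries.C (2 : ℚ_[2]) := by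
    show PowerSeries.map _ _ = _
    rw [PowerSeries.map_C, map_ofNat]
  by_cases hG : G = 0
  · refine ⟨g, 0, 0, hgD, ?_⟩
    rw [hG, map_zero] at hιG
    rw [mul_zero, map_zero, pow_zero, one_mul, hKL]
    exact hιG
  · obtain ⟨htf, hrank⟩ := h124.isTorsionFree_and_rank_le_one W 2 hκ hγ I
    haveI := htf
    haveI : Module.Finite (IwasawaAlgebra 2) Df.X := Df.moduleFinite hγ
    obtain ⟨htors, hlen⟩ := Kato2004.thm17_4_skeleton hrank loc toX δ hPX hXY P.subtype P.injective_subtype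
      (hX0 W 2 κ γ hκ hγ Y) Z hG hGZ
    obtain ⟨m, hm⟩ := exists_pow_mul_mem_charIdeal_of_lengthAt_le htors (IwasawaAlgebra.prime_C 2) hG
      fun 𝔭 h1 hp𝔭 ↦ hlen 𝔭 (hES 𝔭 h1 hp𝔭)
    have hm' : PowerSeries.C (2 : ℤ_[2]) ^ m * G ∈ Ideal.span {g} := by
      rw [← hgD, ← hchar]
      exact hm
    obtain ⟨h, hh⟩ := Ideal.mem_span_singleton'.mp hm'
    refine ⟨g, h, m, hgD, ?_⟩
    rw [mul_comm g h, hh]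
    simp only [map_mul, map_pow, hιG, hKL, h2]
    ring

/-- **K3 `SignedKatoDivisibilityUpToAtTwo` BY NAME from Kato's facts and the ∃-form of the rational ♭ package WITH F3♭ UP TO A UNIT OF `Λ`.**
As `signedKatoDivisibilityUpToAtTwo_of_exists_flatColemanKatoRat`, but the zeta clause F3♭ only asks `ι G = ϖ · ι(u·L♭)` for SOME unit
`u ∈ Λˣ` — absorbing the normalisation of the Honda system / Coleman map and the functional-equation unit relating `L♭` to its image under
the Iwasawa involution (CONVENTION NOTE: the tree's dual data `SharpFlatSelmerDualData` / `FineSelmerDualData` carry the PRE-COMPOSITION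
`Λ`-action `(T·x)(s) = x(conj_γ s) − x(s)` while `Kato2004.IwasawaH1Data` is covariant, cf. the K3 lead's audit `G4-CONVENTION-AUDIT.md`; a
`Λ`-LINEAR skeleton between them at the same generator is the print skeleton up to that involution, whose effect on `L♭` is a unit by the
functional equation — this variant is the form such a witness can meet). K3's cofactor `h` absorbs `u⁻¹`.
[cite: Kato2004Asterisque, Thm. 12.4, Thm. 12.5 (3), Thm. 17.4, §17.13] [cite: Sprung2012, Thm. 2.2 (2′), Prop. 7.19, Thm. 7.16]
[cite: Kobayashi2003, Thm. 1.3 (i)] [cite: Pollack2003, Thm. 5.13 (functional equation)] -/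
theorem signedKatoDivisibilityUpToAtTwo_of_exists_flatColemanKatoRatUnit (h124 : Kato2004.thm12_4)
    (hX0 : Kato2004_fineSelmerDual_isTorsion)
    (hCK : ∀ (W : WeierstrassCurve ℚ) [W.IsElliptic] [W.IsGloballyMinimal],
      ¬ W.HasCM → W.analyticRank = 0 → GoodSS W 2 → W.frobeniusTrace 2 = 0 →
      ∀ (κ : ZpExtension ℚ 2) (γ : Field.absoluteGaloisGroup ℚ),
        κ.IsCyclotomic → κ.IsTopGenerator γ → IsCyclotomicVariable 2 γ →
      ∀ [NeZero (W.conductorNorm ℤ)] (f : CuspForm (Gamma0 (W.conductorNorm ℤ)) 2),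
          IsNewformOf W f → ∀ (ϖ : ℚ), (ϖ : ℝ) * W.realPeriodRat = plusPeriod f →
        ∀ (Ls Lf : IwasawaAlgebra 2), IsSprungPair f 2 (W.frobeniusTrace 2) Ls Lf →
        ∃ (v : HeightOneSpectrum (𝓞 ℚ)) (_ : (2 : 𝓞 ℚ) ∈ v.asIdeal)
          (g : Field.absoluteGaloisGroup (v.adicCompletion ℚ)) (d : ℕ → localPoints W (v.adicCompletion ℚ)),
          κ.IsTopGenerator (resGalOfEmb (closureEmb (K := ℚ) (v.adicCompletion ℚ)) g) ∧
          (∀ m, d m ∈ localLayerPointsOfEmb κ (closureEmb (K := ℚ) (v.adicCompletion ℚ)) W m) ∧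
          (∀ m, localTraceOfEmb κ (closureEmb (K := ℚ) (v.adicCompletion ℚ)) W (m + 1) (m + 2) (d (m + 2)) = -d m) ∧
          (∀ m : ℕ, 1 ≤ m → ∀ P ∈ localLayerPointsOfEmb κ (closureEmb (K := ℚ) (v.adicCompletion ℚ)) W m,
            ∃ B ∈ AddSubgroup.closure (Set.range fun σ : Field.absoluteGaloisGroup (v.adicCompletion ℚ) ↦ σ • d m),
              ∃ P' ∈ localLayerPointsOfEmb κ (closureEmb (K := ℚ) (v.adicCompletion ℚ)) W (m - 1),
              ∃ R ∈ localLayerPointsOfEmb κ (closureEmb (K := ℚ) (v.adicCompletion ℚ)) W m, P = B + P' + 2 • R) ∧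
          (∀ P ∈ localLayerPointsOfEmb κ (closureEmb (K := ℚ) (v.adicCompletion ℚ)) W 0,
            ∃ a : ℤ, ∃ R ∈ localLayerPointsOfEmb κ (closureEmb (K := ℚ) (v.adicCompletion ℚ)) W 0, P = a • d 0 + 2 • R) ∧
          ∀ (D : SharpFlatSelmerDualData W κ γ (closureEmb (K := ℚ) (v.adicCompletion ℚ))
              (W.frobeniusTrace 2) g d .flat) [ContinuousSMul ℤ_[2] (W.tateModule 2)],
            ∃ (I : Kato2004.IwasawaH1Data W 2 κ γ) (Y : W.FineSelmerDualData κ γ)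
              (P : Submodule (IwasawaAlgebra 2) (IwasawaAlgebra 2))
              (loc : I.H →ₗ[IwasawaAlgebra 2] P) (toX : P →ₗ[IwasawaAlgebra 2] D.X)
              (δ : D.X →ₗ[IwasawaAlgebra 2] Y.X) (Z : Submodule (IwasawaAlgebra 2) I.H)
              (G : IwasawaAlgebra 2) (u : (IwasawaAlgebra 2)ˣ),
              Function.Exact loc toX ∧ Function.Exact toX δ ∧
              G ∈ Submodule.map (P.subtype ∘ₗ loc) Z ∧
              iwasawaToPowerSeries 2 G = PowerSeries.C (ϖ : ℚ_[2]) * iwasawaToPowerSeries 2 ((u : IwasawaAlgebra 2) * Lf) ∧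
              (∀ 𝔭 : PrimeSpectrum (IwasawaAlgebra 2), 𝔭.asIdeal.height = 1 →
                PowerSeries.C (2 : ℤ_[2]) ∉ 𝔭.asIdeal →
                lengthAt (IwasawaAlgebra 2) Y.X 𝔭 ≤ lengthAt (IwasawaAlgebra 2) (I.H ⧸ Z) 𝔭)) :
    SignedKatoDivisibilityUpToAtTwo := by
  unfold SignedKatoDivisibilityUpToAtTwo
  intro W _ _ hcm hr hss ha κ γ hκ hγ hcv _ f hf ϖ hϖ Lplus Lminus hPP D
  obtain ⟨-, -, hodd, heven⟩ := hPP
  have hSP : IsSprungPair f 2 (W.frobeniusTrace 2) Lplus Lminus := by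
    rw [ha]
    exact (isSprungPair_zero_iff f 2 Lplus Lminus).mpr ⟨hodd, heven⟩
  have hKL : kobayashiL 1 Lplus Lminus = Lminus := by simp [kobayashiL]
  obtain ⟨v, hv, gl, d, hgl, hd, htr, hgen, hgen0, hpack⟩ :=
    hCK W hcm hr hss ha κ γ hκ hγ hcv f hf ϖ hϖ Lplus Lminus hSP
  have heq0 := signedSelmerInfty_eq_sharpFlatSelmerInfty_flat_two W hss hκ v hv hgl hd htr hgen hgen0
  have key : ∀ (ap : ℤ), ap = 0 →
      ∀ (Df : SharpFlatSelmerDualData W κ γ (closureEmb (K := ℚ) (v.adicCompletion ℚ)) ap gl d .flat),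
        Df.charIdeal = D.charIdeal := by
    rintro ap rfl Df
    exact charIdeal_sharpFlat_eq_charIdeal_signed W κ _ gl d heq0 Df D
  obtain ⟨Df⟩ := nonempty_sharpFlatSelmerDualData' W κ (closureEmb (K := ℚ) (v.adicCompletion ℚ))
    (W.frobeniusTrace 2) gl d Chroma.flat γ
  have hchar : Df.charIdeal = D.charIdeal := key _ ha Df
  haveI : ContinuousSMul ℤ_[2] (W.tateModule 2) := TateModule.continuousSMul_padicInt
  obtain ⟨I, Y, P, loc, toX, δ, Z, G, u, hPX, hXY, hGZ, hιG, hES⟩ := hpack Df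
  obtain ⟨g, hg⟩ := (charIdeal_isPrincipal_holds 2 D.X).principal
  have hgD : D.charIdeal = Ideal.span {g} := hg
  have h2 : iwasawaToPowerSeries 2 (PowerSeries.C (2 : ℤ_[2])) = PowerSeries.C (2 : ℚ_[2]) := by
    show PowerSeries.map _ _ = _
    rw [PowerSeries.map_C, map_ofNat]
  have huu : iwasawaToPowerSeries 2 (u : IwasawaAlgebra 2) * iwasawaToPowerSeries 2 (↑u⁻¹ : IwasawaAlgebra 2) = 1 := by
    rw [← map_mul, Units.mul_inv, map_one]
  by_cases hG : G = 0
  · refine ⟨g, 0, 0, hgD, ?_⟩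
    rw [hG, map_zero] at hιG
    -- `0 = C ϖ · ι u · ι L♭` with `ι u` a unit ⇒ `C ϖ · ι L♭ = 0`
    have hz : PowerSeries.C (ϖ : ℚ_[2]) *
        (iwasawaToPowerSeries 2 (u : IwasawaAlgebra 2) * iwasawaToPowerSeries 2 Lminus) = 0 := by
      rw [← map_mul]; exact hιG.symm
    have h0 : PowerSeries.C (ϖ : ℚ_[2]) * iwasawaToPowerSeries 2 Lminus = 0 := by
      calc PowerSeries.C (ϖ : ℚ_[2]) * iwasawaToPowerSeries 2 Lminus
          = PowerSeries.C (ϖ : ℚ_[2]) * iwasawaToPowerSeries 2 Lminus *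
              (iwasawaToPowerSeries 2 (u : IwasawaAlgebra 2) * iwasawaToPowerSeries 2 (↑u⁻¹ : IwasawaAlgebra 2)) := by
            rw [huu, mul_one]
        _ = PowerSeries.C (ϖ : ℚ_[2]) *
              (iwasawaToPowerSeries 2 (u : IwasawaAlgebra 2) * iwasawaToPowerSeries 2 Lminus) *
              iwasawaToPowerSeries 2 (↑u⁻¹ : IwasawaAlgebra 2) := by ring
        _ = 0 := by rw [hz, zero_mul]
    rw [mul_zero, map_zero, pow_zero, one_mul, hKL]
    exact h0.symm
  · obtain ⟨htf, hrank⟩ := h124.isTorsionFree_and_rank_le_one W 2 hκ hγ I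
    haveI := htf
    haveI : Module.Finite (IwasawaAlgebra 2) Df.X := Df.moduleFinite hγ
    obtain ⟨htors, hlen⟩ := Kato2004.thm17_4_skeleton hrank loc toX δ hPX hXY P.subtype P.injective_subtype
      (hX0 W 2 κ γ hκ hγ Y) Z hG hGZ
    obtain ⟨m, hm⟩ := exists_pow_mul_mem_charIdeal_of_lengthAt_le htors (IwasawaAlgebra.prime_C 2) hG
      fun 𝔭 h1 hp𝔭 ↦ hlen 𝔭 (hES 𝔭 h1 hp𝔭)
    have hm' : PowerSeries.C (2 : ℤ_[2]) ^ m * G ∈ Ideal.span {g} := by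
      rw [← hgD, ← hchar]
      exact hm
    obtain ⟨h, hh⟩ := Ideal.mem_span_singleton'.mp hm'
    refine ⟨g, h * (↑u⁻¹ : IwasawaAlgebra 2), m, hgD, ?_⟩
    rw [← mul_assoc, mul_comm g h, hh]
    simp only [map_mul, map_pow, hιG, hKL, h2]
    calc PowerSeries.C (2 : ℚ_[2]) ^ m *
          (PowerSeries.C (ϖ : ℚ_[2]) * (iwasawaToPowerSeries 2 ↑u * iwasawaToPowerSeries 2 Lminus)) *
          iwasawaToPowerSeries 2 (↑u⁻¹ : IwasawaAlgebra 2)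
        = PowerSeries.C (2 : ℚ_[2]) ^ m * PowerSeries.C (ϖ : ℚ_[2]) * iwasawaToPowerSeries 2 Lminus *
          (iwasawaToPowerSeries 2 (u : IwasawaAlgebra 2) * iwasawaToPowerSeries 2 (↑u⁻¹ : IwasawaAlgebra 2)) := by ring
      _ = PowerSeries.C (2 : ℚ_[2]) ^ m * PowerSeries.C (ϖ : ℚ_[2]) * iwasawaToPowerSeries 2 Lminus := by
          rw [huu, mul_one]

end SignedKatoOffTwo.FlatKernel

end Summit.BirchSwinnertonDyer.BirchSwinnertonDyer.Theorems

end
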